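import Summits.BirchSwinnertonDyer.Rank1Residual.X1.GeneratorCountLayerTransport
import Summits.BirchSwinnertonDyer.Rank1Residual.Additive.BudgetFromRelaxedKummerCount
import Summits.BirchSwinnertonDyer.Rank1Residual.Additive.UnramifiedClassesLocal
import Summits.BirchSwinnertonDyer.Rank1Residual.Additive.RationalClassesToLayerZero
import HarnessLib

/-!
# Route M's generator COUNT at LAYER `n`, IV: the relaxed count with ONE EXTRA PLACE over a number
# field, the local condition there being an arbitrary `𝓛 ⊇ 𝓚` of index `≥ p` — the shell of the
# local term `a` at layer `n` (cell `b2b-bsdres`, unit `b2b-bsdres-eisenstein-p1`, gen 17;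
# X1R0-GAPMAP §26.4 (M1)/(M2))

HONEST FRAMING (run/shared/lean/b2b/bsd-rank1-residual/, verbatim in every file): the goal of the
cell is to DELETE the COMBINATION-SHAPED residual classes of the Birch–Swinnerton-Dyer formula for
ALL analytic-rank `≤ 1` elliptic curves over `ℚ` — "full BSD formula for every rank `≤ 1` curve in
class `C`" assembled STRICTLY from published theorems — so that the rank-`≤ 1` remainder becomes
exactly the CONSTRUCTION-SHAPED classes, which are TYPED (missing-input `Prop`s), NOT attempted.
This is not "finishing BSD". Sub-cell `b2b-bsdres-eisenstein-p1` (CLASS-OWNERS row "X1 (r = 0)"):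
research route; NO CLAIM BEYOND STATED CLASSES; nothing here changes a label; nothing is booked.
THEOREMS ONLY — no definition, no named fact, no typed input introduced; the local data at the extra
place (`𝓛`, its index, the `K_∞`-condition of its classes) are HYPOTHESES; nothing about any
particular curve asserted.

## What and why

Route T's layer-`n` count is `B_n = t_n + a − 2δ` (X1R0-GAPMAP §14.1): FILES 6–8 of gen 17 put
`t_n` (and the `δ`-loss) in the kernel at every layer; the local term `a ∈ {1, 2}` at the prime `𝔭`
of `ℚ_n` above `p` is gen 15's FILE 3 (`X1/GeneratorCountAnomalous`, `+1` over `ℚ`: relax the Kummer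
structure at `v_p` to ALL of `H¹(ℚ_p, E[p])`, index `≥ p`, then V79's `hloc`). At layer `n ≥ 1` NOT
every relaxed class satisfies Greenberg's condition over `ℚ_{n,∞}` (the index of `𝓚_𝔭` in
`H¹((ℚ_n)_𝔭, E[p])` is `#E(L)[p]·p^{pⁿ}`), so the right shell relaxes at `𝔭` to an INTERMEDIATE
local condition `𝓛`, `𝓚_𝔭 ≤ 𝓛`, whose index and whose `K_∞`-local behaviour are the two
genuinely local statements left to prove (X1R0-GAPMAP §26.4 (M1)). This file is that shell, over ANY
number field `K` (n1011's K-general pair count `Additive.finite_and_pow_le_card_selmerGroup_of_kummer_le`,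
K-general verbatim port of gen 15's `exists_addSubgroup_relaxedKummer_atP`):

* §1 `exists_addSubgroup_relaxedKummer_at`: `p` odd; a Poitou–Tate family and the local
  Euler–Poincaré formula over `K` (named facts as hypotheses); Tamagawa witnesses on `T₀` (places
  `v ∤ p`... only `v ∉ {𝔭}` is needed); an extra finite place `𝔭 ∉ T₀` with a local condition
  `𝓛 ≥ 𝓚_𝔭` and `p·#𝓚_𝔭 ≤ #𝓛` ⇒ a FINITE `S ≤ H¹(K, E[p])` with **`#S ≥ p^{#T₀ + 1}`**, Kummer off
  `T₀ ∪ {𝔭}` and at `∞`, `H¹_ur + 𝓚` on `T₀`, in `𝓛` at `𝔭`.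
* §2 `exists_finset_layerZero_of_tamagawaWitnesses_at`: with `E(K)[p] = 0`, `κ` cyclotomic and the
  hypothesis `hloc` (every `y` with `res_𝔭 y ∈ 𝓛` satisfies the `K_∞`-level local condition at `𝔭`):
  **`p^{#T₀ + 1}` classes of `A_0[p]`** (n1011's `exists_finset_torsion_selmerInftyPreimage_zero_card_eq`,
  the `T₀` places by `layerToInfty_resH1Hom_torsionToPrimaryH1_mem_localKerOver_of_mem_unramified_sup_kummer`).
* §3 `succ_card_le_lambda_add_pow_mul_mu_of_tamagawaWitnesses_layer_at`: over the LAYER `K_n` of a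
  `ℤ_p`-extension of `K` with restricted tower `κ_n` (FILE 6): **`#T₀ + 1 ≤ λ(X) + pⁿ μ(X)`** for
  every torsion dual datum of `Sel_{p^∞}(E/K_∞)` without finite submodules — route T's
  `t_n + 1 ≤ λ + pⁿμ`, MODULO the two local hypotheses at `𝔭` (index of `𝓛`, `hloc`).

Nothing is booked by this file; over `ℚ` at layer `0` with `𝓛 = ⊤` it is gen 15's FILE 3 (there the
index is `mul_natCard_kummer_le_natCard_top` and `hloc` is V79, both theorems).

References: [GreenbergLNM1716] §2 Prop. 2.4, §3 p. 88 and Lemma 3.4 (p. 89), §5 pp. 114–118,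
p. 137; [MilneADT2006] Ch. I Thm. 2.8, Lemma 3.3, Thm. 4.10; X1R0-GAPMAP §14.1, §24, §26.
-/

noncomputable section

open scoped Classical

open Function Field NumberField IsDedekindDomain WeierstrassCurve PowerSeries
  Literature.NumberTheory.EllipticCurves Literature.NumberTheory.GaloisRepresentations
  Literature.NumberTheory.GaloisCohomology Summit.BirchSwinnertonDyer.Rank1Residual.GaloisImage
  Literature.NumberTheory.EllipticCurves.IwasawaAlgebra
  Summit.BirchSwinnertonDyer.Rank1Residual.Additive
  Summit.BirchSwinnertonDyer.Rank1Residual.Additive.ZpTower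
  Summit.BirchSwinnertonDyer.Rank1Residual.X1.GeneratorBoundMuLayer
  Summit.BirchSwinnertonDyer.Rank1Residual.X1.GeneratorCountLayerTransport
open Literature.NumberTheory.GaloisRepresentations.DiscreteGaloisModule (SelmerStructure unramifiedSubgroup)

set_option autoImplicit false

namespace Summit.BirchSwinnertonDyer.Rank1Residual.X1.GeneratorCountLayerAtP

variable {K : Type} [Field K] [NumberField K] {W : WeierstrassCurve K} [W.IsElliptic] {p : ℕ}
  [hp : Fact p.Prime]

/-! ## §1. The relaxed-Kummer count with one extra place and an intermediate local condition -/

/-- **The relaxed-Kummer count with one extra place.** `p` odd; `inv` a Poitou–Tate family and `hEP`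
the local Euler–Poincaré formula over `K`; `T₀` finite places carrying Tamagawa witnesses (an
unramified non-Kummer class); `𝔭 ∉ T₀` an extra finite place with a local condition `𝓛 ⊇ 𝓚_𝔭` of
index at least `p` (`p·#𝓚_𝔭 ≤ #𝓛`). Then there is a FINITE subgroup `S ≤ H¹(K, E[p])` with
`#S ≥ p^{#T₀ + 1}` whose classes are Kummer at every finite place off `T₀ ∪ {𝔭}` and at infinity,
lie in `H¹_ur + 𝓚_v` at `v ∈ T₀`, and in `𝓛` at `𝔭` — `S = H¹_𝓖(K, E[p])` for the Kummer
structure relaxed by the unramified classes on `T₀` and by `𝓛` at `𝔭`, counted by n1011's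
`Additive.finite_and_pow_le_card_selmerGroup_of_kummer_le` (Wiles / DDT 2.19 pair counting).
[cite: GreenbergLNM1716, §5 pp. 114–118] [cite: MilneADT2006, Ch. I Thm. 2.8, Thm. 4.10] -/
theorem exists_addSubgroup_relaxedKummer_at (hodd : p ≠ 2)
    (inv : LocalInvariants K p) (hperf : inv.IsPerfect) (hsum : inv.SumLocalTermEqZero)
    (hcompl : inv.SelmerComplement)
    (hEP : ∀ v : HeightOneSpectrum (𝓞 K), localEulerPoincareCharacteristic (v.adicCompletion K))
    (T₀ : Finset (HeightOneSpectrum (𝓞 K)))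
    (hwit : ∀ v ∈ T₀, ∃ u ∈ unramifiedSubgroup
        ((W.torsionGaloisModule (p : ℤ)).restrictField (v.adicCompletion K)) 1,
      u ∉ W.kummerLocalConditionAt (p : ℤ) (v.adicCompletion K))
    (vp : HeightOneSpectrum (𝓞 K)) (hvpT₀ : vp ∉ T₀)
    (𝓛 : ∀ v : HeightOneSpectrum (𝓞 K),
      AddSubgroup (galoisCohomology ((W.torsionGaloisModule (p : ℤ)).toLocal (Sum.inr v)) 1))
    (h𝓛 : W.kummerSelmerStructure (p : ℤ) (Sum.inr vp) ≤ 𝓛 vp)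
    (hidx : p * Nat.card (W.kummerSelmerStructure (p : ℤ) (Sum.inr vp)) ≤ Nat.card (𝓛 vp)) :
    ∃ S : AddSubgroup (galH1Torsion W (p : ℤ)), Finite S ∧ p ^ (T₀.card + 1) ≤ Nat.card S ∧
      ∀ y ∈ S,
        (∀ v ∉ (↑(insert vp T₀) : Set (HeightOneSpectrum (𝓞 K))),
            y ∈ selmerLocalKer W (v.adicCompletion K) (p : ℤ)) ∧
        (∀ w : InfinitePlace K, y ∈ selmerLocalKer W w.Completion (p : ℤ)) ∧
        (∀ v ∈ T₀, galoisCohomology.res (W.torsionGaloisModule (p : ℤ)) (v.adicCompletion K) 1 y ∈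
          unramifiedSubgroup ((W.torsionGaloisModule (p : ℤ)).restrictField (v.adicCompletion K)) 1 ⊔
            W.kummerLocalConditionAt (p : ℤ) (v.adicCompletion K)) ∧
        galoisCohomology.localization (W.torsionGaloisModule (p : ℤ)) (Sum.inr vp) 1 y ∈ 𝓛 vp := by
  haveI : NeZero p := ⟨hp.out.ne_zero⟩
  haveI : Finite (geomTorsion W (p : ℤ)) := finite_geomTorsion_of_neZero W p
  -- a finite set `T ⊇ T₀ ∪ {vp} ∪ {bad} ∪ {v ∣ p}` of finite places
  have hbadfin : {v : HeightOneSpectrum (𝓞 K) | ¬ W.HasGoodReductionAt v}.Finite := by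
    have h := W.eventually_hasGoodReductionAt
    rwa [Filter.eventually_cofinite] at h
  have hp0 : (Ideal.span {((p : ℕ) : 𝓞 K)} : Ideal (𝓞 K)) ≠ 0 := by
    rw [Ne, Ideal.zero_eq_bot, Ideal.span_singleton_eq_bot]
    exact_mod_cast hp.out.ne_zero
  have hpfin : {v : HeightOneSpectrum (𝓞 K) | ((p : ℕ) : 𝓞 K) ∈ v.asIdeal}.Finite := by
    refine (Ideal.finite_factors hp0).subset fun v hv ↦ ?_
    exact (Ideal.dvd_span_singleton).mpr hv
  set T₁ : Finset (HeightOneSpectrum (𝓞 K)) := insert vp T₀ with hT₁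
  obtain ⟨T, hT₁T, hTp, hTbad⟩ : ∃ T : Finset (HeightOneSpectrum (𝓞 K)), T₁ ⊆ T ∧
      (∀ v, ((p : ℕ) : 𝓞 K) ∈ v.asIdeal → v ∈ T) ∧ ∀ v, ¬ W.HasGoodReductionAt v → v ∈ T :=
    ⟨T₁ ∪ (hbadfin.toFinset ∪ hpfin.toFinset), Finset.subset_union_left,
      fun v hv ↦ Finset.mem_union_right _ (Finset.mem_union_right _ (hpfin.mem_toFinset.mpr hv)),
      fun v hv ↦ Finset.mem_union_right _ (Finset.mem_union_left _ (hbadfin.mem_toFinset.mpr hv))⟩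
  have hS : ∀ v ∉ T, ((p : ℕ) : 𝓞 K) ∉ v.asIdeal ∧
      GaloisRep.IsUnramifiedAt v (W.torsionGaloisModule (p : ℤ)) := fun v hv ↦ by
    have hpv : ((p : ℕ) : 𝓞 K) ∉ v.asIdeal := fun h ↦ hv (hTp v h)
    have hgood : W.HasGoodReductionAt v := by_contra fun h ↦ hv (hTbad v h)
    exact ⟨hpv, X11b.AcSelmer.isUnramifiedAt_torsionGaloisModule W hgood
      (by rw [Int.cast_natCast]; exact hpv)⟩
  have hfs_p : ∀ v : HeightOneSpectrum (𝓞 K), ((p : ℕ) : 𝓞 K) ∈ v.asIdeal →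
      (Sum.inr v : Place K) ∈ finSupport T := fun v hv ↦ (inr_mem_finSupport_iff T v).mpr (hTp v hv)
  have hfs_bad : ∀ v : HeightOneSpectrum (𝓞 K), ¬ W.HasGoodReductionAt v →
      (Sum.inr v : Place K) ∈ finSupport T := fun v hv ↦ (inr_mem_finSupport_iff T v).mpr (hTbad v hv)
  have h𝓚 : (W.kummerSelmerStructure (p : ℤ)).IsUnramifiedOutside (finSupport T) := by
    have h1 := X11b.KummerDuality.kummerSelmerStructure_isUnramifiedOutside W p 1
      (finSupport T) (inl_mem_finSupport T) hfs_p hfs_bad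
    rwa [pow_one] at h1
  -- the relaxed structure `𝓖`: `𝓛` at `vp`, `H¹_ur + 𝓚_v` on `T₀`, `𝓚_v` elsewhere
  obtain ⟨𝓖, h𝓖inl, h𝓖vp, h𝓖T₀, h𝓖off⟩ : ∃ 𝓖 : SelmerStructure (W.torsionGaloisModule (p : ℤ)),
      (∀ w : InfinitePlace K, 𝓖 (Sum.inl w) = W.kummerSelmerStructure (p : ℤ) (Sum.inl w)) ∧
      𝓖 (Sum.inr vp) = 𝓛 vp ∧
      (∀ v ∈ T₀, 𝓖 (Sum.inr v) =
        unramifiedSubgroup (GaloisRep.toLocal v (W.torsionGaloisModule (p : ℤ))) 1 ⊔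
          W.kummerSelmerStructure (p : ℤ) (Sum.inr v)) ∧
      (∀ v ∉ T₁, 𝓖 (Sum.inr v) = W.kummerSelmerStructure (p : ℤ) (Sum.inr v)) := by
    refine ⟨fun w ↦ match w with
      | Sum.inl w => W.kummerSelmerStructure (p : ℤ) (Sum.inl w)
      | Sum.inr v => if v = vp then 𝓛 v else if v ∈ T₀ then
          unramifiedSubgroup (GaloisRep.toLocal v (W.torsionGaloisModule (p : ℤ))) 1 ⊔
            W.kummerSelmerStructure (p : ℤ) (Sum.inr v)
        else W.kummerSelmerStructure (p : ℤ) (Sum.inr v),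
      fun _ ↦ rfl, if_pos rfl, fun v hv ↦ ?_, fun v hv ↦ ?_⟩
    · have hne : v ≠ vp := fun h ↦ hvpT₀ (h ▸ hv)
      exact (if_neg hne).trans (if_pos hv)
    · have hne : v ≠ vp := fun h ↦ hv (h ▸ Finset.mem_insert_self vp T₀)
      have hv' : v ∉ T₀ := fun h ↦ hv (Finset.mem_insert_of_mem h)
      exact (if_neg hne).trans (if_neg hv')
  have hle : W.kummerSelmerStructure (p : ℤ) ≤ 𝓖 := by
    rintro (w | v)
    · rw [h𝓖inl w]
    · by_cases hv : v = vp
      · subst hv; rw [h𝓖vp]; exact h𝓛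
      by_cases hv' : v ∈ T₀
      · rw [h𝓖T₀ v hv']; exact le_sup_right
      · rw [h𝓖off v (by rw [Finset.mem_insert, not_or]; exact ⟨hv, hv'⟩)]
  have h𝓖ur : 𝓖.IsUnramifiedOutside (finSupport T) := by
    refine ⟨inl_mem_finSupport T, fun v hv ↦ ?_⟩
    have hvT : v ∉ T := fun h ↦ hv ((inr_mem_finSupport_iff T v).mpr h)
    rw [h𝓖off v fun h ↦ hvT (hT₁T h)]
    exact h𝓚.2 v hv
  have hbig : ∀ v ∈ T₁, p * Nat.card (W.kummerSelmerStructure (p : ℤ) (Sum.inr v)) ≤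
      Nat.card (𝓖 (Sum.inr v)) := fun v hv ↦ by
    rcases Finset.mem_insert.mp hv with rfl | hv
    · rw [h𝓖vp]; exact hidx
    · haveI := finite_galoisCohomology_one_toLocal (W.torsionGaloisModule (p : ℤ)) v
      obtain ⟨u, hu, huK⟩ := hwit v hv
      refine Additive.mul_card_le_card_of_lt
        (Additive.smul_galoisCohomology_toLocal_torsion_eq_zero W p v) ?_
      rw [h𝓖T₀ v hv]
      exact right_lt_sup.mpr fun h ↦ huK (h hu)
  obtain ⟨hfin, hcard⟩ := Additive.finite_and_pow_le_card_selmerGroup_of_kummer_le W p hodd inv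
    hperf hsum hcompl hEP T hS h𝓚 hle h𝓖ur (fun w ↦ (h𝓖inl w).symm) T₁ hT₁T hbig
  have hcardT₁ : T₁.card = T₀.card + 1 := Finset.card_insert_of_notMem hvpT₀
  refine ⟨𝓖.selmerGroup, hfin, hcardT₁ ▸ hcard,
    fun y hy ↦ ⟨fun v hv ↦ ?_, fun w ↦ ?_, fun v hv ↦ ?_, ?_⟩⟩
  · have hv' : v ∉ T₁ := by rwa [hT₁, ← Finset.mem_coe]
    have h := (𝓖.mem_selmerGroup_iff y).mp hy (Sum.inr v)
    rw [h𝓖off v hv'] at h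
    have h' : y ∈ (W.kummerSelmerStructure (p : ℤ) (Sum.inr v)).comap
        (galoisCohomology.localization (W.torsionGaloisModule (p : ℤ)) (Sum.inr v) 1) := h
    rw [comap_localization_kummerSelmerStructure] at h'
    exact h'
  · have h := (𝓖.mem_selmerGroup_iff y).mp hy (Sum.inl w)
    rw [h𝓖inl w] at h
    have h' : y ∈ (W.kummerSelmerStructure (p : ℤ) (Sum.inl w)).comap
        (galoisCohomology.localization (W.torsionGaloisModule (p : ℤ)) (Sum.inl w) 1) := h
    rw [comap_localization_kummerSelmerStructure] at h'
    exact h'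
  · have h := (𝓖.mem_selmerGroup_iff y).mp hy (Sum.inr v)
    rw [h𝓖T₀ v hv] at h
    exact h
  · have h := (𝓖.mem_selmerGroup_iff y).mp hy (Sum.inr vp)
    rw [h𝓖vp] at h
    exact h

/-! ## §2. `p^{#T₀ + 1}` classes of `A_0[p]`, modulo the `K_∞`-local condition at the extra place -/

/-- **`p^{#T₀ + 1}` classes of `A_0[p]`** for a cyclotomic `κ` over `K`, when `E(K)[p] = 0`, `p` is
odd, `T₀` carries Tamagawa witnesses at places `v ∤ p`, and at the extra place `𝔭` a local condition
`𝓛 ⊇ 𝓚_𝔭` of index `≥ p` is given ALL of whose classes satisfy the `K_∞`-level local condition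
(`hloc`: for `y ∈ H¹(K, E[p])` with `res_𝔭 y ∈ 𝓛`, `h_0(Ψ y) ∈ localKerOver p (ker κ) K_𝔭`). §1's
subgroup transported by n1011's `exists_finset_torsion_selmerInftyPreimage_zero_card_eq`; the `T₀`
places by `layerToInfty_resH1Hom_torsionToPrimaryH1_mem_localKerOver_of_mem_unramified_sup_kummer`.
[cite: GreenbergLNM1716, §3 pp. 85–89 and §5 pp. 114–118] -/
theorem exists_finset_layerZero_of_tamagawaWitnesses_at (hodd : p ≠ 2)
    (hK : ∀ P : W.toAffine.Point, p • P = 0 → P = 0)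
    (inv : LocalInvariants K p) (hperf : inv.IsPerfect) (hsum : inv.SumLocalTermEqZero)
    (hcompl : inv.SelmerComplement)
    (hEP : ∀ v : HeightOneSpectrum (𝓞 K), localEulerPoincareCharacteristic (v.adicCompletion K))
    (T₀ : Finset (HeightOneSpectrum (𝓞 K))) (hT₀p : ∀ v ∈ T₀, ((p : ℕ) : 𝓞 K) ∉ v.asIdeal)
    (hwit : ∀ v ∈ T₀, ∃ u ∈ unramifiedSubgroup
        ((W.torsionGaloisModule (p : ℤ)).restrictField (v.adicCompletion K)) 1,
      u ∉ W.kummerLocalConditionAt (p : ℤ) (v.adicCompletion K))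
    (vp : HeightOneSpectrum (𝓞 K)) (hvpT₀ : vp ∉ T₀)
    (𝓛 : ∀ v : HeightOneSpectrum (𝓞 K),
      AddSubgroup (galoisCohomology ((W.torsionGaloisModule (p : ℤ)).toLocal (Sum.inr v)) 1))
    (h𝓛 : W.kummerSelmerStructure (p : ℤ) (Sum.inr vp) ≤ 𝓛 vp)
    (hidx : p * Nat.card (W.kummerSelmerStructure (p : ℤ) (Sum.inr vp)) ≤ Nat.card (𝓛 vp))
    (κ : ZpExtension K p) (hκ : κ.IsCyclotomic)
    (hloc : ∀ y : galH1Torsion W (p : ℤ),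
      galoisCohomology.localization (W.torsionGaloisModule (p : ℤ)) (Sum.inr vp) 1 y ∈ 𝓛 vp →
      W.layerToInfty κ 0 (resH1Hom (Literature.NumberTheory.EllipticCurves.subgroupIncl (κ.layerSubgroup 0))
          (AddMonoidHom.id (geomPrimaryTorsion W p)) (fun _ _ ↦ rfl) (torsionToPrimaryH1 W p y)) ∈
        W.localKerOver p κ.kerSubgroup (vp.adicCompletion K)) :
    ∃ s : Finset {z : W.selmerInftyPreimage κ 0 // p • z = 0}, p ^ (T₀.card + 1) ≤ s.card := by
  obtain ⟨S, hSfin, hcard, hS⟩ := exists_addSubgroup_relaxedKummer_at hodd inv hperf hsum hcompl hEP T₀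
    hwit vp hvpT₀ 𝓛 h𝓛 hidx
  haveI := hSfin
  obtain ⟨s, hs⟩ := Additive.exists_finset_torsion_selmerInftyPreimage_zero_card_eq W p κ
    (fun P hP ↦ hK P (by convert hP)) S
    (↑(insert vp T₀) : Set (HeightOneSpectrum (𝓞 K))) (fun y hy v hv ↦ (hS y hy).1 v hv)
    (fun y hy w ↦ (hS y hy).2.1 w) fun y hy v hv ↦ by
      rcases Finset.mem_insert.mp (Finset.mem_coe.mp hv) with rfl | hv
      · exact hloc y (hS y hy).2.2.2
      · exact Additive.layerToInfty_resH1Hom_torsionToPrimaryH1_mem_localKerOver_of_mem_unramified_sup_kummer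
          W p κ v (hT₀p v hv) (Additive.exists_apply_resGal_ne_one_of_isCyclotomic κ hκ v (hT₀p v hv)) y
          ((hS y hy).2.2.1 v hv)
  exact ⟨s, hs ▸ hcard⟩

/-! ## §3. Over the layer `K_n`: `#T₀ + 1 ≤ λ + pⁿ μ` modulo the two local hypotheses at `𝔭` -/

section Layer

variable {κ : ZpExtension K p} (n : ℕ) (κn : ZpExtension (κ.layer n) p)
  (hκn : ∀ σ : Field.absoluteGaloisGroup (κ.layer n),
    (κn σ).toAdd * (p : ℤ_[p]) ^ n = (κ (resGal (K := K) (κ.layer n) σ)).toAdd)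
  {γ : Field.absoluteGaloisGroup K} (D : W.SelmerDualData κ γ)

include hκn

/-- **Route T at layer `n` WITH one local class: `#T₀ + 1 ≤ λ(X) + pⁿ μ(X)`**, modulo the two
local hypotheses at the extra place `𝔭` of `K_n` (a local condition `𝓛 ⊇ 𝓚_𝔭` of index `≥ p` and
the `K_{n,∞}`-condition of its classes, `hloc`) — FILE 6's count over the restricted tower `κ_n`
(cyclotomic when `κ` is) fed by §2 over `K_n`, bounded by FILE 5. With `𝓛`/`hloc` supplied at the
prime above `p` this is X1R0-GAPMAP §14.1's `t_n + a − 2δ ≤ λ + pⁿμ` at `a = 1`, `δ = 0`.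
[cite: GreenbergLNM1716, §3 Lemma 3.4, §5 pp. 114–118, p. 137] -/
theorem succ_card_le_lambda_add_pow_mul_mu_of_tamagawaWitnesses_layer_at
    [Module.Finite (IwasawaAlgebra p) D.X] [NumberField (κ.layer n)] (hodd : p ≠ 2)
    (hX : D.IsTorsion) (hnf : ∀ N : Submodule (IwasawaAlgebra p) D.X, Finite N → N = ⊥)
    (hK : ∀ P : W.toAffine.Point, p • P = 0 → P = 0) (hκ : κ.IsCyclotomic)
    (inv : LocalInvariants (κ.layer n) p) (hperf : inv.IsPerfect) (hsum : inv.SumLocalTermEqZero)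
    (hcompl : inv.SelmerComplement)
    (hEP : ∀ w : HeightOneSpectrum (𝓞 (κ.layer n)),
      localEulerPoincareCharacteristic (w.adicCompletion (κ.layer n)))
    (T₀ : Finset (HeightOneSpectrum (𝓞 (κ.layer n))))
    (hT₀p : ∀ w ∈ T₀, ((p : ℕ) : 𝓞 (κ.layer n)) ∉ w.asIdeal)
    (hwit : ∀ w ∈ T₀, ∃ u ∈ unramifiedSubgroup
        (((W.baseChange (κ.layer n)).torsionGaloisModule (p : ℤ)).restrictField
          (w.adicCompletion (κ.layer n))) 1,
      u ∉ (W.baseChange (κ.layer n)).kummerLocalConditionAt (p : ℤ) (w.adicCompletion (κ.layer n)))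
    (wp : HeightOneSpectrum (𝓞 (κ.layer n))) (hwpT₀ : wp ∉ T₀)
    (𝓛 : ∀ w : HeightOneSpectrum (𝓞 (κ.layer n)), AddSubgroup (galoisCohomology
      (((W.baseChange (κ.layer n)).torsionGaloisModule (p : ℤ)).toLocal (Sum.inr w)) 1))
    (h𝓛 : (W.baseChange (κ.layer n)).kummerSelmerStructure (p : ℤ) (Sum.inr wp) ≤ 𝓛 wp)
    (hidx : p * Nat.card ((W.baseChange (κ.layer n)).kummerSelmerStructure (p : ℤ) (Sum.inr wp)) ≤
      Nat.card (𝓛 wp))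
    (hloc : ∀ y : galH1Torsion (W.baseChange (κ.layer n)) (p : ℤ),
      galoisCohomology.localization ((W.baseChange (κ.layer n)).torsionGaloisModule (p : ℤ))
        (Sum.inr wp) 1 y ∈ 𝓛 wp →
      (W.baseChange (κ.layer n)).layerToInfty κn 0
          (resH1Hom (Literature.NumberTheory.EllipticCurves.subgroupIncl (κn.layerSubgroup 0))
            (AddMonoidHom.id (geomPrimaryTorsion (W.baseChange (κ.layer n)) p)) (fun _ _ ↦ rfl)
            (torsionToPrimaryH1 (W.baseChange (κ.layer n)) p y)) ∈
        (W.baseChange (κ.layer n)).localKerOver p κn.kerSubgroup (wp.adicCompletion (κ.layer n))) :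
    T₀.card + 1 ≤ lambdaInvariant p D.X + p ^ n * muInvariant p D.X := by
  have hKn : ∀ Q : (W.baseChange (κ.layer n)).toAffine.Point, p • Q = 0 → Q = 0 :=
    forall_smul_eq_zero_baseChange_layer W p κ hK n
  have hκnc : κn.IsCyclotomic := ZpTower.isCyclotomic_restrictTower κ n κn hκn hκ
  obtain ⟨s, hs⟩ := exists_finset_layerZero_of_tamagawaWitnesses_at (W := W.baseChange (κ.layer n))
    hodd (fun Q hQ ↦ hKn Q (by convert hQ)) inv hperf hsum hcompl hEP T₀ hT₀p hwit wp hwpT₀ 𝓛 h𝓛 hidx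
    κn hκnc hloc
  exact (Nat.pow_le_pow_iff_right (Nat.Prime.one_lt hp.out)).mp
    ((hs.trans (GeneratorCountLayerTransport.card_le_natCard_quotient_layerIdeal_of_restrictTower n κn
      hκn D hK s)).trans (natCard_quotient_layerIdeal_le_pow D.X hX hnf n))

end Layer

end Summit.BirchSwinnertonDyer.Rank1Residual.X1.GeneratorCountLayerAtP

end
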